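import Summits.QuantumFields.YangMills.Theorems.PencilRigidityDiagonalMirrorRPRStubRpClosureDefs

/-!
# Crux `DiagonalMirrorRPR` (stmt-QuantumFields-10604), line `sign-twisted-diagonal-trace`, construction F1_diag
# (director-ym O4 WORD 3 (A)): the Wilson DIAGONAL two-step transfer construction — vocabulary (kernel level)

Helper for the crux `DiagonalMirrorRPR` of `YangMills` (routes `IsotropyFromPowerCounting`, `MirrorModularBoosts`,
`PencilRigidity`; item stmt-QuantumFields-10604), attached `--supports … --as helper`; it closes nothing by itself.
Companion theorems: `…Theorems.DiagonalMirrorRPRWilsonDiagonalModel`; the interface the construction is to inhabit: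
`…Theorems.DiagonalMirrorRPRDiagonalSliceModelDefs` (`DiagonalSliceModel`, re-homed from the core workfile
`Cruxes/DiagonalMirrorRPR/Lines/sign_twisted_diagonal_trace_core.lean`, sha16 `8055703b7f1e70ed`).

WHAT IS BUILT HERE (definitions, over the LANDED box-torus calculus `TSite/TConfig/tstep/tplaq/taction/tweight/thaar/tZ/texp`
of `…PencilRigidityDiagonalMirrorRPRStubRpClosureDefs`, sheared mode `shear = true`):

* §1 `diagSite : Site 4 S ≃ TSite S S S`, the LIGHT-CONE CHART `x ↦ (x₀ − x₁, x₁, x₂, x₃)` of the standard torus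
  `(ℤ/Sℤ)⁴` of `wilsonMeasure`: its first coordinate is the diagonal slab index `v = x₀ − x₁`, and it carries the unit
  steps to the SHEARED box steps (`e₁ ↦ (−1, 1, 0, 0)`, `diagSite_single`) — so the scheme's own torus of side
  `S_k = 2L_k + 1` IS the sheared box torus `(S_k, S_k, S_k)` (`diagConfigEquiv`, `plaquetteHolonomy_diagConfig`); no
  cover, no oddness needed for this step.
* §2 the LAYER DECOMPOSITION of the sheared box torus `TConfig M n₁ N` along `v ∈ ℤ_M`: layer `Z_v : LayerCfg n₁ N G`
  = the in-slab links (directions `2, 3`) of slab `v` together with the bond links between slabs `v − 1` and `v` (the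
  `e₀`-bonds arriving at slab `v`, the `e₁`-bonds leaving it backwards); `layerEquiv : TConfig M n₁ N G ≃ᵐ (ℤ_M → LayerCfg)`.
* §3 the explicit STEP TABLE `stepPlaq Z Z' s i j` (the six plaquette holonomies booked with the step `v → v+1`), the
  STEP ACTION `stepAction ρ Z Z' = Σ_s Σ_{i<j} Re tr ρ(stepPlaq …)`, the TWO-STEP DIAGONAL TRANSFER KERNEL
  `stepKernel ρ β Z Z' = exp(β · stepAction ρ Z Z') > 0`, the layer Haar measure and the CYCLIC TRACE
  `diagCyclicTrace ρ β M n₁ N = ∫ ∏_{v : ℤ_M} K(Z_v, Z_{v+1}) dHaar` ("`Tr K^M`").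

The companion file PROVES: `taction ρ true U = Σ_v stepAction ρ (Z_v U) (Z_{v+1} U)` (every plaquette booked exactly
once), `tweight = ∏_v K`, `layerEquiv`/`diagConfigEquiv` preserve product Haar measure, `tZ … true = diagCyclicTrace`,
`texp … true F = (∫ F ∏K)/(∫ ∏K)`, `∫ F d(wilsonMeasure ρ β) = Re texp ρ β true (F ∘ diagConfig)`, hence
`latticeSchwinger` at step `k` = the normalised cyclic `S_k`-fold `K`-integral with the smeared product inserted; and the
regularity of `K` (jointly continuous, bounded, strongly measurable — the hypotheses of
`Literature/Analysis/OperatorTheory/PositiveKernelTransferOperator.lean` & co.).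

WHAT IS OWED (honest; director-ym's (A) asks for `wilsonDiagonalModel r sch hβ : DiagonalSliceModel r sch` with ALL
fields proved — NOT reached by this file): the step kernel `K` is Hilbert–Schmidt but NOT symmetric — the diagonal chain
alternates two different half steps, the `(01)`-cut `Ê` (positive semidefinite for `β ≥ 0`: `exp(β Re tr ρ(g h⁻¹))` is of
positive type) and the `(02),(03),(12),(13)`-coupling `Ô` (indefinite: the wrong-sign sector), each Θ-pseudo-symmetric for
the swap-induced label involution (`WrongSignAnnex.step_eq_hat_mul_hat`, `SketchSeat2Annex.lean`); the self-adjoint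
realisation `A = Ê^{1/2} Ô Ê^{1/2}` (same non-zero spectrum as `K = Ê Ô`), its Hilbert–Schmidt property
(`‖Ê^{1/2} Ô Ê^{1/2}‖_HS ≤ ‖Ê Ô‖_HS`, a Heinz–Kato interpolation step), the trace formulas `Σ λ_j^m = diagCyclicTrace … m`
(trace cyclicity with one bounded factor), and the `famObs` pairing / weight-domination identities are the remaining
layers (operator, spectral, pairing) of F1_diag.  Nothing here is registered; no stub is claimed.

HONEST FRAMING: a construction helper; nothing about D_old ⟨10604⟩, the RP crux to be filed by the FOLD restate, or the
summit is proved; ⟨10604⟩/⟨17721⟩ stay OPEN; the Yang–Mills mass gap is NOT proved here or anywhere in the tree.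

References: K. Osterwalder, E. Seiler, Ann. Phys. 110 (1978) 440, §2–3 (transfer matrix of lattice gauge theory);
E. Seiler, LNP 159 (1982) Ch. 2; M. Lüscher, Comm. Math. Phys. 54 (1977) 283; J. Fröhlich, R. Israel, E. Lieb, B. Simon,
Comm. Math. Phys. 62 (1978) Thm 2.1 (45° tori).
-/

set_option autoImplicit false

noncomputable section

open MeasureTheory
open Literature.MathematicalPhysics.QuantumLattice Literature.MathematicalPhysics.QuantumFieldTheory
open Summit.QuantumFields.YangMills.Cruxes.DiagonalMirrorRPR.ParityBridgeColdTraces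

namespace Summit.QuantumFields.YangMills.Cruxes.DiagonalMirrorRPR.SignTwistedDiagonalTrace.WilsonDiagonal

/-! ## §1 The light-cone chart: the standard torus `(ℤ/Sℤ)⁴` IS the sheared box torus `(S, S, S)` -/

section Chart

variable {S : ℕ}

/-- The light-cone chart `x ↦ (x₀ − x₁, x₁, x₂, x₃)` of the standard torus: the first coordinate is the diagonal
slab index `v = x₀ − x₁` (the swap `x₀ ↔ x₁` acts by `v ↦ −v` followed by `x₁ ↦ x₁ + v`), and the unit steps
`e₀, e₁, e₂, e₃` become the SHEARED box-torus steps `tstep true` (`e₁ ↦ (−1, 1, 0, 0)`). -/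
def diagSite : Literature.MathematicalPhysics.QuantumFieldTheory.Site 4 S ≃ TSite S S S where
  toFun x := (x 0 - x 1, x 1, x 2, x 3)
  invFun y := ![y.1 + y.2.1, y.2.1, y.2.2.1, y.2.2.2]
  left_inv x := by funext i; fin_cases i <;> simp
  right_inv y := by obtain ⟨a, b, c, d⟩ := y; simp

/-- The chart is additive. -/
theorem diagSite_add (x y : Literature.MathematicalPhysics.QuantumFieldTheory.Site 4 S) :
    diagSite (x + y) = diagSite x + diagSite y := by
  simp only [diagSite, Equiv.coe_fn_mk, Pi.add_apply, Prod.mk_add_mk]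
  refine Prod.ext ?_ rfl
  simp only
  abel

/-- The chart maps the unit steps of the standard torus to the sheared box-torus steps. -/
theorem diagSite_single (i : Fin 4) :
    diagSite (Pi.single i (1 : ZMod S) : Literature.MathematicalPhysics.QuantumFieldTheory.Site 4 S) =
      (tstep true i : TSite S S S) := by
  fin_cases i <;> simp [diagSite, tstep]

/-- The induced relabelling of positively oriented edges. -/
def diagEdge : Literature.MathematicalPhysics.QuantumFieldTheory.Edge 4 S ≃ TEdge S S S :=
  diagSite.prodCongr (Equiv.refl (Fin 4))

variable {G : Type*}

/-- Transport of a sheared box configuration to the standard torus along the light-cone chart. -/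
def diagConfig (V : TConfig S S S G) : GaugeConfig 4 S G := fun e => V (diagEdge e)

/-- Plaquette holonomies agree under the transport (the standard plaquette at `x` in the plane `(i, j)` is the sheared
box plaquette at `diagSite x`). -/
theorem plaquetteHolonomy_diagConfig [Group G] (V : TConfig S S S G)
    (x : Literature.MathematicalPhysics.QuantumFieldTheory.Site 4 S) (i j : Fin 4) :
    plaquetteHolonomy (diagConfig V) x i j = tplaq true V (diagSite x) i j := by
  simp only [plaquetteHolonomy, diagConfig, diagEdge, Equiv.prodCongr_apply, Prod.map_apply, Equiv.coe_refl, id_eq,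
    Literature.MathematicalPhysics.QuantumFieldTheory.Site.shift, diagSite_add, diagSite_single, tplaq]

variable [MeasurableSpace G]

/-- The light-cone chart as a measurable equivalence of configuration spaces. -/
def diagConfigEquiv : TConfig S S S G ≃ᵐ GaugeConfig 4 S G :=
  MeasurableEquiv.piCongrLeft (fun _ : Literature.MathematicalPhysics.QuantumFieldTheory.Edge 4 S => G)
    (diagEdge (S := S)).symm

/-- The measurable equivalence is the transport. -/
theorem diagConfigEquiv_apply (V : TConfig S S S G) : diagConfigEquiv V = diagConfig V := by
  funext e
  simp only [diagConfigEquiv, MeasurableEquiv.coe_piCongrLeft, Equiv.piCongrLeft_apply_eq_cast, cast_eq,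
    Equiv.symm_symm, diagConfig]

end Chart

/-! ## §2 Layers of the sheared box torus along `v`: in-slab links and incoming bond links -/

section Layers

/-- Sites of one diagonal slab `v = const`: `(x₁, x₂, x₃) ∈ ℤ_{n₁} × ℤ_N × ℤ_N`. -/
abbrev SlabSite (n₁ N : ℕ) : Type := ZMod n₁ × ZMod N × ZMod N

/-- Link labels of one layer: `(s, 0)` = the `e₀`-bond ARRIVING at slab site `s` (based in the previous slab), `(s, 1)` =
the `e₁`-bond LEAVING `s` (it lands in the previous slab at `s + ê₁`), `(s, 2)`, `(s, 3)` = the in-slab links at `s`. -/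
abbrev LayerIdx (n₁ N : ℕ) : Type := SlabSite n₁ N × Fin 4

/-- Configurations of one layer (`Z_v`: the in-slab links of slab `v` and the bond links between slabs `v − 1` and
`v`). -/
abbrev LayerCfg (n₁ N : ℕ) (G : Type*) : Type _ := LayerIdx n₁ N → G

variable {M n₁ N : ℕ}

/-- The layer an edge belongs to: its base slab, except that `e₀`-bonds are booked with the slab they arrive at. -/
def layerTime (e : TEdge M n₁ N) : ZMod M := if e.2 = 0 then e.1.1 + 1 else e.1.1

/-- The relabelling `edge ↦ (layer, label)` of the sheared box torus. -/
def layerEdge : TEdge M n₁ N ≃ ZMod M × LayerIdx n₁ N where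
  toFun e := (layerTime e, (e.1.2, e.2))
  invFun q := ((if q.2.2 = 0 then q.1 - 1 else q.1, q.2.1), q.2.2)
  left_inv e := by
    obtain ⟨⟨t, s⟩, i⟩ := e
    by_cases h : i = 0 <;> simp [layerTime, h]
  right_inv q := by
    obtain ⟨t, s, i⟩ := q
    by_cases h : i = 0 <;> simp [layerTime, h]

variable {G : Type*}

/-- Reading a sheared box configuration layer by layer. -/
def layerRead (U : TConfig M n₁ N G) (t : ZMod M) : LayerCfg n₁ N G := fun p => U (layerEdge.symm (t, p))

/-- Assembling a sheared box configuration from its layers. -/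
def layerAssemble (Z : ZMod M → LayerCfg n₁ N G) : TConfig M n₁ N G := fun e => Z (layerEdge e).1 (layerEdge e).2

/-- Reading the layers: `e₀`-bonds come from the previous slab, everything else from the slab itself. -/
theorem layerRead_apply (U : TConfig M n₁ N G) (t : ZMod M) (s : SlabSite n₁ N) (i : Fin 4) :
    layerRead U t (s, i) = U ((if i = 0 then t - 1 else t, s), i) := rfl

/-- `layerAssemble ∘ layerRead = id`. -/
theorem layerAssemble_layerRead (U : TConfig M n₁ N G) : layerAssemble (layerRead U) = U := by
  funext e
  simp only [layerAssemble, layerRead]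
  rw [show ((layerEdge e).1, (layerEdge e).2) = layerEdge e from rfl, Equiv.symm_apply_apply]

/-- `layerRead ∘ layerAssemble = id`. -/
theorem layerRead_layerAssemble (Z : ZMod M → LayerCfg n₁ N G) : layerRead (layerAssemble Z) = Z := by
  funext t p
  simp only [layerRead, layerAssemble, Equiv.apply_symm_apply]

variable [MeasurableSpace G]

/-- **The layer equivalence** `TConfig M n₁ N G ≃ᵐ (ZMod M → LayerCfg n₁ N G)` (edge relabelling, then currying). -/
def layerEquiv : TConfig M n₁ N G ≃ᵐ (ZMod M → LayerCfg n₁ N G) :=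
  (MeasurableEquiv.piCongrLeft (fun _ : ZMod M × LayerIdx n₁ N => G) (layerEdge (M := M) (n₁ := n₁) (N := N))).trans
    (MeasurableEquiv.curry (ZMod M) (LayerIdx n₁ N) G)

/-- The layer equivalence reads layers. -/
theorem layerEquiv_apply (U : TConfig M n₁ N G) : layerEquiv U = layerRead U := by
  funext t p
  simp only [layerEquiv, MeasurableEquiv.trans_apply, MeasurableEquiv.coe_curry, Function.curry_apply,
    MeasurableEquiv.coe_piCongrLeft, Equiv.piCongrLeft_apply_eq_cast, cast_eq, layerRead]

/-- Its inverse assembles layers. -/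
theorem layerEquiv_symm_apply (Z : ZMod M → LayerCfg n₁ N G) : (layerEquiv (G := G)).symm Z = layerAssemble Z := by
  have h : layerEquiv (layerAssemble Z) = Z := by rw [layerEquiv_apply, layerRead_layerAssemble]
  rw [← h, MeasurableEquiv.symm_apply_apply, h]

end Layers

/-! ## §3 The step action and the two-step diagonal transfer kernel -/

section Kernel

variable {n₁ N : ℕ} [NeZero n₁] [NeZero N]

/-- The slab components of the sheared unit steps: `ê₀ = 0` (pure time step), `ê₁ = (1,0,0)`, `ê₂`, `ê₃`. -/
def slabStep (j : Fin 4) : SlabSite n₁ N :=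
  ![((0 : ZMod n₁), (0 : ZMod N), (0 : ZMod N)), ((1 : ZMod n₁), (0 : ZMod N), (0 : ZMod N)),
    ((0 : ZMod n₁), (1 : ZMod N), (0 : ZMod N)), ((0 : ZMod n₁), (0 : ZMod N), (1 : ZMod N))] j

variable {G : Type*} [Group G]

/-- **The six plaquette holonomies of one diagonal step** `Z → Z'` (layers `v`, `v+1`) at slab site `s`, as a `4 × 4`
table in the plane indices (entries off the six planes `i < j` are junk `1`).  With `Z = Z_v`, `Z' = Z_{v+1}` read off a
sheared box configuration `U` (`layerRead`): planes `(0,1)`, `(0,2)`, `(0,3)`, `(2,3)` are the plaquettes of `U` based at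
`(v, s)`, planes `(1,2)`, `(1,3)` those based at `(v+1, s)` (`stepPlaq_eq_tplaq_*`); every plaquette of the torus is
booked with exactly one step. -/
def stepPlaq (Z Z' : LayerCfg n₁ N G) (s : SlabSite n₁ N) : Fin 4 → Fin 4 → G :=
  ![![1, Z' (s, 0) * Z' (s, 1) * (Z (s + slabStep 1, 0))⁻¹ * (Z (s, 1))⁻¹,
      Z' (s, 0) * Z' (s, 2) * (Z' (s + slabStep 2, 0))⁻¹ * (Z (s, 2))⁻¹,
      Z' (s, 0) * Z' (s, 3) * (Z' (s + slabStep 3, 0))⁻¹ * (Z (s, 3))⁻¹],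
    ![1, 1, Z' (s, 1) * Z (s + slabStep 1, 2) * (Z' (s + slabStep 2, 1))⁻¹ * (Z' (s, 2))⁻¹,
      Z' (s, 1) * Z (s + slabStep 1, 3) * (Z' (s + slabStep 3, 1))⁻¹ * (Z' (s, 3))⁻¹],
    ![1, 1, 1, Z (s, 2) * Z (s + slabStep 2, 3) * (Z (s + slabStep 3, 2))⁻¹ * (Z (s, 3))⁻¹],
    ![1, 1, 1, 1]]

variable {Nc : ℕ} (ρ : G →* Matrix (Fin Nc) (Fin Nc) ℂ)

/-- **The step action**: Wilson's plaquette sum `Σ_s Σ_{i<j} Re tr ρ(stepPlaq Z Z' s i j)` of ONE diagonal step — all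
plaquettes of the sheared box torus booked with the step `v → v+1` (`taction_eq_sum_stepAction`). -/
def stepAction (Z Z' : LayerCfg n₁ N G) : ℝ :=
  ∑ s : SlabSite n₁ N, ∑ i : Fin 4, ∑ j : Fin 4, if i < j then (ρ (stepPlaq Z Z' s i j)).trace.re else 0

/-- **The two-step diagonal transfer kernel of Wilson's measure** `K(Z, Z') = exp(β · stepAction Z Z')` on layer
configurations: a strictly positive, bounded, continuous kernel on the compact group `G^{LayerIdx}` whose `M`-fold cyclic
integral is the partition function of the sheared box torus with `M` slabs (`tZ_true_eq_integral_prod_stepKernel`) — for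
`M = S` and the chart of §1, Wilson's partition function on the standard torus of side `S` (§4).  It is NOT symmetric
(the diagonal chain alternates two different half steps; see the file docstring). -/
def stepKernel (β : ℝ) (Z Z' : LayerCfg n₁ N G) : ℝ :=
  Real.exp (β * stepAction ρ Z Z')

/-- The step kernel is strictly positive. -/
theorem stepKernel_pos (β : ℝ) (Z Z' : LayerCfg n₁ N G) : 0 < stepKernel ρ β Z Z' := Real.exp_pos _

/-! ### Layer Haar measure and the cyclic trace -/

variable [TopologicalSpace G] [IsTopologicalGroup G] [CompactSpace G] [MeasurableSpace G] [BorelSpace G]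

/-- Product Haar probability measure on one layer. -/
def layerHaar (n₁ N : ℕ) [NeZero n₁] [NeZero N] (G : Type*) [Group G] [TopologicalSpace G] [MeasurableSpace G]
    [BorelSpace G] [IsTopologicalGroup G] [CompactSpace G] : Measure (LayerCfg n₁ N G) :=
  Measure.pi fun _ : LayerIdx n₁ N => haarProbability G

/-- **The cyclic trace of the step kernel** over `M` layers, `∫ ∏_{v : ℤ_M} K(Z_v, Z_{v+1}) dHaar` — the partition
function of the sheared box torus `(M, n₁, N)` (`tZ_true_eq_diagCyclicTrace`), i.e. `Tr K^M` once `K` is realised as a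
Hilbert–Schmidt operator. -/
def diagCyclicTrace (β : ℝ) (M n₁ N : ℕ) [NeZero M] [NeZero n₁] [NeZero N] : ℝ :=
  ∫ Z : ZMod M → LayerCfg n₁ N G, ∏ t : ZMod M, stepKernel ρ β (Z t) (Z (t + 1))
    ∂(Measure.pi fun _ : ZMod M => layerHaar n₁ N G)

end Kernel

end Summit.QuantumFields.YangMills.Cruxes.DiagonalMirrorRPR.SignTwistedDiagonalTrace.WilsonDiagonal

end
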